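import Literature.Analysis.Complex.TuranFirstMainTheorem
import Mathlib.RingTheory.PowerSeries.Derivative
import Mathlib.Analysis.Complex.Basic
import HarnessLib

/-!
# Local positivity of Rankin–Selberg coefficients: `L_p(s, π × π̃)` has non-negative coefficients

Topic `Literature/NumberTheory/LFunctions`. Definitions with bodies and theorems (no named fact).

For an "alphabet" of local parameters `v : ι → ℂ` (`ι` finite; model: the Satake parameters of an
unramified local component, or any finite multiset of complex numbers) the local Euler factor
`∏_i (1 − v_i X)⁻¹` is the power series `satakeSeries v = ∏_i ∑_n v_iⁿ Xⁿ` (the tree's `geomSeries` of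
`Literature/Analysis/Complex/TuranFirstMainTheorem`, reused), whose
coefficients are the complete homogeneous symmetric polynomials `h_n(v)`. We prove:

* `satakeSeries_newton` — **Newton's identity for `h`**: `n·h_n(v) = ∑_{r=1}^{n} p_r(v) h_{n−r}(v)`
  with the power sums `p_r(v) = ∑_i v_iʳ` (`powerSum`), from the logarithmic derivative
  `X (∏ G_i)' = (∏ G_i) · ∑_i P_i`, `X G_c' = G_c P_c`, `P_c = ∑_{r ≥ 1} cʳ Xʳ`;
* `coeff_satakeSeries_nonneg_of_powerSum_nonneg` — if every power sum `p_r(v)`, `r ≥ 1`, is a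
  non-negative real then every coefficient `h_n(v)` is a non-negative real (induction on `n`);
* `powerSum_tensorConj`, **`coeff_satakeSeries_tensorConj_nonneg`** — for the alphabet
  `u ⊗ ū : (i, j) ↦ u_i conj(u_j)` one has `p_r(u ⊗ ū) = |p_r(u)|² ≥ 0`, hence ALL coefficients of
  `∏_{i,j}(1 − u_i ū_j X)⁻¹` are `≥ 0`. This is the local content of the classical fact that the
  Rankin–Selberg `L`-function `L(s, π × π̃)` has non-negative Dirichlet coefficients
  (Iwaniec–Kowalski, §5.12, remark after Theorem 5.42: "`Tr(ρ ⊗ ρ̄)(g) = |Tr ρ(g)|²`, which gives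
  `Λ(p^k) ≥ 0` for all `k ≥ 1`"; the passage from the logarithmic coefficients `Λ` to the
  coefficients themselves is Newton's identity above, instead of the exponential series);
* `satakeSeries_pair_unit`, `coeff_zeta_mul_symmSq_local_nonneg` — the rank-two unitary case
  `u = (α, ᾱ)`, `|α| = 1`: `u ⊗ ū = (1, α², ᾱ², 1)`, i.e. the local factor of `ζ(s)L(s, Sym² f)`
  (`= L(s, f × f̄)`) at a prime where `f` is unramified and tempered has non-negative coefficients —
  the input `coeff₁` of the Siegel scheme for symmetric squares
  (`SiegelTheoremPairAbstract.lean`, model Hoffstein–Lockhart); the pair input `coeff₃`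
  (`ζ L(Sym² f) L(Sym² g) L(Sym² f × Sym² g) = L((f ⊗ f̄) × (g ⊗ ḡ))` locally) is
  `coeff_satakeSeries_tensorConj_nonneg` for the four-letter alphabet `u ⊗ u'`
  (`coeff_pair_symmSq_local_nonneg`).

## References

* H. Iwaniec, E. Kowalski, *Analytic Number Theory*, AMS Colloq. Publ. 53 (2004), §5.12, the remark
  after Theorem 5.42 (read in the Harbin 2023 Chinese edition, isbn 9787576716252, Explorer
  panama:498164666728485, chars 296000–318000). [cite: IwaniecKowalski2004, §5.12 (after Thm. 5.42)]
* I. G. Macdonald, *Symmetric functions and Hall polynomials*, 2nd ed. (1995), I (2.10)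
  (`n h_n = ∑_{r=1}^n p_r h_{n−r}`). [folklore]

## Mathlib / tree search

Mathlib: `PowerSeries.derivative` (a `Derivation`, `Derivation.leibniz`), `PowerSeries.coeff_derivative`,
`PowerSeries.coeff_succ_X_mul`, `PowerSeries.coeff_mul`, `Finset.antidiagonal`;
`MvPolynomial.psum_*`/`MvPolynomial.mul_esymm_eq_sum` (Newton for `e`, not used). The order on `ℂ` is
Mathlib's `Complex.partialOrder` (`open scoped ComplexOrder`: `z ≤ w ↔ re ≤ re ∧ im = im`).
Tree: `Literature.Analysis.Complex.PowerSum.geomSeries`, `one_sub_mul_geomSeries`,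
`norm_coeff_prod_geomSeries_le` (`TuranFirstMainTheorem.lean`; the first two reused);
`lean search 'satake|Newton.*hsymm|Rankin.*nonneg'` — nothing of this kind; other `geomSeries`/`powerSum`
declarations in the tree live in other namespaces with other meanings.
-/

noncomputable section

open PowerSeries Finset
open scoped ComplexOrder ComplexConjugate

namespace Literature.NumberTheory.LFunctions

open Literature.Analysis.Complex.PowerSum (geomSeries one_sub_mul_geomSeries)

/-! ### The local series of an alphabet

The geometric series `geomSeries c = ∑_n cⁿXⁿ` (`(1 − cX) · geomSeries c = 1`,
`one_sub_mul_geomSeries`) is the tree's `Literature.Analysis.Complex.PowerSum.geomSeries`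
(`TuranFirstMainTheorem.lean`), reused rather than re-declared. -/

/-- The local Euler factor `∏_i (1 − v_i X)⁻¹` of a finite alphabet `v : ι → ℂ`, as a power series
(its coefficients are the complete homogeneous symmetric polynomials `h_n(v)`). [folklore] -/
def satakeSeries {ι : Type*} [Fintype ι] (v : ι → ℂ) : PowerSeries ℂ := ∏ i, geomSeries (v i)

/-- The power sums `p_r(v) = ∑_i v_iʳ`. [folklore] -/
def powerSum {ι : Type*} [Fintype ι] (v : ι → ℂ) (r : ℕ) : ℂ := ∑ i, v i ^ r

/-- The series `P_c = ∑_{r ≥ 1} cʳ Xʳ` (`= cX/(1 − cX)`, the logarithmic derivative `X G_c'/G_c`). [folklore] -/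
def logDerivSeries (c : ℂ) : PowerSeries ℂ := PowerSeries.mk fun n => if n = 0 then 0 else c ^ n

/-- The coefficients of the geometric series: `cⁿ`. [folklore] -/
@[simp] theorem coeff_geomSeries (c : ℂ) (n : ℕ) : coeff n (geomSeries c) = c ^ n := by
  simp [geomSeries]

/-- The coefficients of `P_c`: `0, c, c², …`. [folklore] -/
@[simp] theorem coeff_logDerivSeries (c : ℂ) (n : ℕ) :
    coeff n (logDerivSeries c) = if n = 0 then 0 else c ^ n := by
  simp [logDerivSeries]

/-- The constant coefficient of a geometric series is `1`. [folklore] -/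
@[simp] theorem constantCoeff_geomSeries (c : ℂ) : constantCoeff (geomSeries c) = 1 := by
  rw [← coeff_zero_eq_constantCoeff_apply, coeff_geomSeries, pow_zero]

/-- The constant coefficient of a local factor is `1`. [folklore] -/
@[simp] theorem constantCoeff_satakeSeries {ι : Type*} [Fintype ι] (v : ι → ℂ) :
    constantCoeff (satakeSeries v) = 1 := by
  simp [satakeSeries, map_prod]

/-- `h_0(v) = 1`. [folklore] -/
@[simp] theorem coeff_zero_satakeSeries {ι : Type*} [Fintype ι] (v : ι → ℂ) :
    coeff 0 (satakeSeries v) = 1 := by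
  rw [coeff_zero_eq_constantCoeff_apply, constantCoeff_satakeSeries]

/-- Local factors multiply over a disjoint union of alphabets (here: a product index). [folklore] -/
theorem satakeSeries_prod_index {ι κ : Type*} [Fintype ι] [Fintype κ] (v : ι × κ → ℂ) :
    satakeSeries v = ∏ i, satakeSeries fun j => v (i, j) := by
  unfold satakeSeries
  exact Fintype.prod_prod_type (f := fun x : ι × κ => geomSeries (v x))

/-- Local factors are invariant under re-indexing the alphabet. [folklore] -/
theorem satakeSeries_comp_equiv {ι κ : Type*} [Fintype ι] [Fintype κ] (e : ι ≃ κ) (v : κ → ℂ) :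
    satakeSeries (v ∘ e) = satakeSeries v := by
  unfold satakeSeries
  exact Fintype.prod_equiv e _ _ fun _ => rfl

/-! ### The logarithmic derivative and Newton's identity -/

/-- `X G_c' = G_c · P_c` for the geometric series. [folklore] -/
theorem X_mul_derivative_geomSeries (c : ℂ) :
    X * derivative ℂ (geomSeries c) = geomSeries c * logDerivSeries c := by
  ext n
  rcases n with _ | n
  · simp [coeff_mul]
  · rw [coeff_succ_X_mul, coeff_derivative, coeff_geomSeries, coeff_mul,
      show (∑ p ∈ Finset.antidiagonal (n + 1), coeff p.1 (geomSeries c) * coeff p.2 (logDerivSeries c)) =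
          ∑ k ∈ Finset.range (n + 1).succ, coeff k (geomSeries c) * coeff (n + 1 - k) (logDerivSeries c) from
        Finset.Nat.sum_antidiagonal_eq_sum_range_succ
          (fun i j => coeff i (geomSeries c) * coeff j (logDerivSeries c)) (n + 1),
      Finset.sum_range_succ]
    simp only [coeff_geomSeries, coeff_logDerivSeries, Nat.sub_self, if_true, mul_zero, add_zero]
    have h : ∀ k ∈ Finset.range (n + 1),
        c ^ k * (if n + 1 - k = 0 then (0 : ℂ) else c ^ (n + 1 - k)) = c ^ (n + 1) := by
      intro k hk
      have hk' := Finset.mem_range.mp hk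
      rw [if_neg (by omega), ← pow_add]
      congr 1; omega
    rw [Finset.sum_congr rfl h, Finset.sum_const, Finset.card_range, nsmul_eq_mul]
    push_cast; ring

/-- `X (∏_{i∈s} G_{v_i})' = (∏_{i∈s} G_{v_i}) · ∑_{i∈s} P_{v_i}` (logarithmic derivatives add). [folklore] -/
theorem X_mul_derivative_prod_geomSeries {ι : Type*} (v : ι → ℂ) (s : Finset ι) :
    X * derivative ℂ (∏ i ∈ s, geomSeries (v i)) =
      (∏ i ∈ s, geomSeries (v i)) * ∑ i ∈ s, logDerivSeries (v i) := by
  classical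
  induction s using Finset.induction_on with
  | empty => simp
  | insert a s ha ih =>
    rw [Finset.prod_insert ha, Finset.sum_insert ha, Derivation.leibniz, smul_eq_mul, smul_eq_mul,
      mul_add]
    have e1 : X * (geomSeries (v a) * derivative ℂ (∏ i ∈ s, geomSeries (v i))) =
        geomSeries (v a) * (X * derivative ℂ (∏ i ∈ s, geomSeries (v i))) := by ring
    have e2 : X * ((∏ i ∈ s, geomSeries (v i)) * derivative ℂ (geomSeries (v a))) =
        (∏ i ∈ s, geomSeries (v i)) * (X * derivative ℂ (geomSeries (v a))) := by ring
    rw [e1, e2, ih, X_mul_derivative_geomSeries]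
    ring

/-- `X (∏_i G_{v_i})' = (∏_i G_{v_i}) · ∑_i P_{v_i}`. [folklore] -/
theorem X_mul_derivative_satakeSeries {ι : Type*} [Fintype ι] (v : ι → ℂ) :
    X * derivative ℂ (satakeSeries v) = satakeSeries v * ∑ i, logDerivSeries (v i) :=
  X_mul_derivative_prod_geomSeries v Finset.univ

/-- **Newton's identity for the complete homogeneous symmetric functions**:
`n · h_n(v) = ∑_{(a,b), a+b=n, b ≥ 1} h_a(v) p_b(v)`, i.e. `n h_n = ∑_{r=1}^n p_r h_{n−r}`.
[cite: IwaniecKowalski2004, §5.12 (after Thm. 5.42)] -/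
theorem satakeSeries_newton {ι : Type*} [Fintype ι] (v : ι → ℂ) (n : ℕ) :
    (n : ℂ) * coeff n (satakeSeries v) =
      ∑ x ∈ Finset.antidiagonal n,
        coeff x.1 (satakeSeries v) * (if x.2 = 0 then 0 else powerSum v x.2) := by
  have key := congrArg (coeff n) (X_mul_derivative_satakeSeries v)
  have hl : coeff n (X * derivative ℂ (satakeSeries v)) = (n : ℂ) * coeff n (satakeSeries v) := by
    rcases n with _ | n
    · simp
    · rw [coeff_succ_X_mul, coeff_derivative]; push_cast; ring
  rw [hl, coeff_mul] at key
  rw [key]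
  refine Finset.sum_congr rfl fun x _ => ?_
  congr 1
  rw [map_sum]
  simp only [coeff_logDerivSeries, powerSum]
  split_ifs with h
  · simp
  · rfl

/-! ### Positivity -/

/-- **Non-negative power sums give non-negative coefficients**: if `p_r(v)` is a non-negative real
for every `r ≥ 1` then so is every `h_n(v)` (strong induction on `n` through Newton's identity).
[cite: IwaniecKowalski2004, §5.12 (after Thm. 5.42)] -/
theorem coeff_satakeSeries_nonneg_of_powerSum_nonneg {ι : Type*} [Fintype ι] (v : ι → ℂ)
    (hp : ∀ r, 1 ≤ r → 0 ≤ powerSum v r) (n : ℕ) : 0 ≤ coeff n (satakeSeries v) := by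
  induction n using Nat.strong_induction_on with
  | _ n ih =>
    rcases n with _ | n
    · rw [coeff_zero_satakeSeries]; exact zero_le_one
    · have key := satakeSeries_newton v (n + 1)
      have hsum : 0 ≤ ∑ x ∈ Finset.antidiagonal (n + 1),
          coeff x.1 (satakeSeries v) * (if x.2 = 0 then 0 else powerSum v x.2) := by
        refine Finset.sum_nonneg fun x hx => ?_
        have hx' := Finset.mem_antidiagonal.mp hx
        split_ifs with h
        · simp
        · exact mul_nonneg (ih x.1 (by omega)) (hp x.2 (by omega))
      rw [← key] at hsum
      obtain ⟨hre, him⟩ := Complex.nonneg_iff.mp hsum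
      simp only [Complex.mul_re, Complex.mul_im, Complex.natCast_re, Complex.natCast_im, zero_mul,
        sub_zero, add_zero] at hre him
      have hn : (0 : ℝ) < ((n + 1 : ℕ) : ℝ) := by positivity
      exact Complex.nonneg_iff.mpr ⟨(mul_nonneg_iff_of_pos_left hn).mp hre,
        ((mul_eq_zero.mp him.symm).resolve_left hn.ne').symm⟩

/-- Power sums of a tensor-conjugate alphabet: `p_r(u ⊗ ū) = p_r(u) · conj p_r(u) = |p_r(u)|²`. [folklore] -/
theorem powerSum_tensorConj {ι : Type*} [Fintype ι] (u : ι → ℂ) (r : ℕ) :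
    powerSum (fun x : ι × ι => u x.1 * conj (u x.2)) r = powerSum u r * conj (powerSum u r) := by
  unfold powerSum
  rw [map_sum, Finset.sum_mul_sum, ← Finset.univ_product_univ, Finset.sum_product]
  refine Finset.sum_congr rfl fun i _ => Finset.sum_congr rfl fun j _ => ?_
  rw [mul_pow, map_pow]

/-- **`L_p(π × π̃)` has non-negative coefficients**: for every finite alphabet `u`, all coefficients
of `∏_{i,j} (1 − u_i ū_j X)⁻¹` are non-negative reals. [cite: IwaniecKowalski2004, §5.12 (after Thm. 5.42)] -/
theorem coeff_satakeSeries_tensorConj_nonneg {ι : Type*} [Fintype ι] (u : ι → ℂ) (n : ℕ) :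
    0 ≤ coeff n (satakeSeries fun x : ι × ι => u x.1 * conj (u x.2)) := by
  refine coeff_satakeSeries_nonneg_of_powerSum_nonneg _ (fun r _ => ?_) n
  rw [powerSum_tensorConj, Complex.mul_conj]
  exact Complex.zero_le_real.mpr (Complex.normSq_nonneg _)

/-! ### The rank-two unitary case: `ζ · L(Sym² f)` and the pair product -/

/-- For `|α| = 1` the tensor-conjugate alphabet of `u = (α, ᾱ)` is `(1, α², ᾱ², 1)`:
`∏_{i,j}(1 − u_iū_jX)⁻¹ = G_1 · G_{α²} · (G_{ᾱ²} · G_1)`, the local factor of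
`ζ(s) · L(s, Sym² f) = L(s, f × f̄)` at a prime where `f` has Satake parameters `α, ᾱ`. [folklore] -/
theorem satakeSeries_pair_unit (α : ℂ) (hα : ‖α‖ = 1) :
    satakeSeries (fun x : Fin 2 × Fin 2 => (![α, conj α] x.1) * conj (![α, conj α] x.2)) =
      geomSeries 1 * geomSeries (α ^ 2) * (geomSeries (conj α ^ 2) * geomSeries 1) := by
  have h1 : α * conj α = 1 := by
    rw [Complex.mul_conj, Complex.normSq_eq_norm_sq, hα]; simp
  have h2 : conj α * α = 1 := by rw [mul_comm, h1]
  rw [satakeSeries_prod_index]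
  simp only [satakeSeries, Fin.prod_univ_two, Matrix.cons_val_zero, Matrix.cons_val_one,
    Complex.conj_conj]
  rw [h1, h2, sq, sq]

/-- **The local factor of `ζ(s)L(s, Sym² f)` has non-negative coefficients** at a prime where the
form is unramified with unitary Satake parameters `α, ᾱ` (`|α| = 1`; for the newform of an elliptic
curve over `ℚ` this is Hasse's bound): the input `coeff₁` of the Siegel scheme for symmetric
squares, locally. [cite: IwaniecKowalski2004, §5.12 (after Thm. 5.42)] -/
theorem coeff_zeta_mul_symmSq_local_nonneg (α : ℂ) (hα : ‖α‖ = 1) (n : ℕ) :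
    0 ≤ coeff n (geomSeries 1 * geomSeries (α ^ 2) * (geomSeries (conj α ^ 2) * geomSeries 1)) := by
  rw [← satakeSeries_pair_unit α hα]
  exact coeff_satakeSeries_tensorConj_nonneg _ n

/-- **The local factor of `ζ L(Sym² f) L(Sym² g) L(Sym² f × Sym² g)` has non-negative coefficients**
in the form used by the Siegel scheme (`coeff₃`): with `u = (α, ᾱ) ⊗ (γ, γ̄)` (four letters) the
sixteen-letter alphabet `u ⊗ ū` is `(1, α², ᾱ², 1) ⊗ (1, γ², γ̄², 1)`, the local parameters of
`L((f ⊗ f̄) × (g ⊗ ḡ)) = ζ · L(Sym² f) · L(Sym² g) · L(Sym² f × Sym² g)`; its coefficients are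
`≥ 0` for ANY `α, γ` (unitarity is only needed to identify the alphabet). [cite: IwaniecKowalski2004, §5.12 (after Thm. 5.42)] -/
theorem coeff_pair_symmSq_local_nonneg (α γ : ℂ) (n : ℕ) :
    0 ≤ coeff n (satakeSeries fun x : (Fin 2 × Fin 2) × (Fin 2 × Fin 2) =>
      (![α, conj α] x.1.1 * ![γ, conj γ] x.1.2) * conj (![α, conj α] x.2.1 * ![γ, conj γ] x.2.2)) :=
  coeff_satakeSeries_tensorConj_nonneg (fun y : Fin 2 × Fin 2 => ![α, conj α] y.1 * ![γ, conj γ] y.2) n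

end Literature.NumberTheory.LFunctions

end
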